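import Summits.QuantumAdvantage.QuantumAdvantage.Theses.ArithStatLadder
import Literature.Computability.Cryptography.HallgrenClassGroup
import Literature.NumberTheory.QuadraticFields.ClassNumberOneLandauProofs
import Literature.NumberTheory.QuadraticFields.AmbiguousClasses
import Literature.NumberTheory.QuadraticFields.DedekindZetaReducedForms
import Literature.NumberTheory.QuadraticFields.FundamentalDiscriminant
import Literature.Computability.Complexity.TautCertificates
import Literature.Computability.Complexity.CircuitClassesUniformProofs
import Literature.Computability.Complexity.CircuitClassesProofs
import Literature.Computability.Complexity.CircuitComposition
import Literature.Computability.Complexity.LupanovBound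
import Literature.Computability.Complexity.PPolyComplement
import Literature.Computability.Complexity.PPolyReductions
import Literature.Computability.Complexity.PPolyTuringClosure
import Literature.Computability.Complexity.Space
import Literature.Computability.Complexity.ProbabilisticClassesProofs
import Literature.Computability.AlgebraicComplexity.BurgisserThm41Proofs
import Literature.Computability.QuantumComplexity.FactoringPrimesProofs
import Literature.Barriers.QuantumAdvantage.NaturalProofs
import Literature.Barriers.PneNP.NaturalProofs

/-!
# Disproof of `IqThreeNotPPoly` (crux `stmt-QuantumAdvantage-2422`, route ArithStatLadder) — findings

Standing adversary file (cdisprove, cycle 1). **Verdict so far: NO KILL; no unconditional kill is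
available to present-day mathematics, and no junk route exists in the tree's definitions.**

`IqThreeNotPPoly` is LITERALLY `IQ3 ∉ P/poly` (`iqThreeNotPPoly_iff`, `Iff.rfl`) with
`IQ3 = bin {d : −d fundamental, 3 ∣ h(−d)}` (`h = BinaryQuadraticForm.classNumber` = number of
reduced primitive forms, computable; `bin` = image of Mathlib's LSB-first `encodeNat`; `P/poly` =
polynomial-size `B₂` straight-line circuit families deciding the language on EVERY word, canonical or
not). A refutation is therefore EXACTLY a polynomial-size circuit family computing `h(−d) mod 3`-
divisibility on fundamental discriminants (`not_iqThreeNotPPoly_iff_exists`) — an algorithmic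
breakthrough: no classical algorithm for `h(−d) mod ℓ`, `ℓ` odd, faster than computing the whole
class group is known (best: Hafner–McCurley 1989, expected time `L_d(1/2, √2)` UNDER GRH,
doi:10.2307/1990896; deterministic `d^{1/4+ε}` Shanks), even given the factorisation of `d`
(genus theory controls only `ℓ = 2`). Nothing in the tree's model shortcuts this (§0, §1, §4(c)).

Findings, all `lean check`ed (rc 0, no `sorry`):

* §0 READING. `iqThreeNotPPoly_iff`, `not_iqThreeNotPPoly_iff` (¬S ↔ `IQ3 ∈ P/poly`),
  `not_iqThreeNotPPoly_iff_exists` (¬S ↔ an explicit poly-size `B₂` family `Decides` IQ3).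
* §1 SMALL MODELS. `h(−3) = h(−4) = h(−19) = 1`, `h(−23) = h(−31) = 3` by `decide`; `3, 4, 19 ∉ S`,
  `23, 31 ∈ S`; the language is neither `0` nor `univ`, `[] ∉ IQ3`, and its length-5 slice is
  non-constant (`slice_five_nonconst`: `bin 19 ∉`, `bin 23 ∈`, both of length 5). So neither the
  `∅`/`univ` shortcut nor "constant slices ⇒ SIZE(1)" applies.
* §2 THE REFUTATION INTERFACE (what ¬S needs) and THE PROOF INTERFACE (why S is hypothesis-type):
  ¬S follows from ANY of `IQ3 ∈ P` (`not_iqThreeNotPPoly_of_mem_P`, tree theorem `P ⊆ P/poly`),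
  `IQ3 ∈ BPP` (`…_of_mem_BPP`, Adleman, tree theorem), `IQ3 ≤ᵀₚ A` with `A ∈ P/poly`
  (`…_of_turingReducible`), `IQ3 ≤ₚ A` (`…_of_karpReducible`) — none is in print for ANY `A` believed
  easy. Conversely S gives `IQ3 ∉ BPP`, `IQ3 ∉ P` (`not_mem_BPP_of`, `not_mem_P_of`), the summit with
  `IqThreeMemBQP` (`quantumAdvantage_of` — NB the deciding theorem only USES `IQ3 ∉ BPP`,
  `quantumAdvantage_of_not_mem_BPP`: the uniform top `IQ3 ∉ BPP` would suffice and is weaker than X),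
  and `PSPACE ⊄ P/poly` modulo the folklore `IQ3 ∈ PSPACE` (`PSPACE_not_subset_PPoly_of`; `h(−d)` is
  even a `#P` function: count reduced pairs `(a,b)`); sharper, modulo the printed `IQ3 ∈ NP` (cubic-form
  witnesses, Hasse 1930): `NP ⊄ P/poly` and `P ≠ NP` (`NP_not_subset_PPoly_of`, `P_ne_NP_of`). Natural-proofs barrier, instantiated: under
  RR Thm 4.1 (tree fact) + `HardPRGExist` no natural property contains the slices of IQ3 infinitely
  often (`no_naturalProof_iqThree`), while such a property WOULD prove S (`iqThreeNotPPoly_of_naturalProof`).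
* §3 LOAD-BEARING ANALYSIS (the crux has no hypotheses; its implicit parameters were mutated):
  (a) fundamentality conjunct: dropping it ADDS every `d ≡ 1, 2 (mod 4)` (`h = 0`, `3 ∣ 0`:
  `three_dvd_classNumber_of_not_discr`, `mem_withoutFund_of_mod_four`) — a different, equally
  unrefutable language; but the conjunct BUNDLES SQUAREFREE RECOGNITION into IQ3 (not known in
  P/poly; factoring-computable), so S may hold for a factoring-type reason. The factoring-free core is
  the PRIME sub-language `IQ3′ = bin {p prime, p ≡ 3 (4), 3 ∣ h(−p)}`: `IQ3′ = IQ3 ⊓ bin(primes ≡ 3 (4))`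
  (`primeIqThreeLang_eq`: `IQ3′ = IQ3 ⊓ PRIMES`), hence `IQ3′ ∉ P/poly ⇒ S` UNCONDITIONALLY, since
  `PRIMES ∈ P` (AKS) is PROVED in the tree (`PRIMES_mem_P'`) — `iqThreeNotPPoly_of_prime`;
  contrapositively a refutation of S refutes the prime version too (`not_prime_of_not`). Planner
  note: S ⇐ PrimeIQ3 ∉ P/poly is the honest "factoring-independent" top rung. FULL SANDWICH (§3(a′),
  hypothesis-free, kernel-checked): `Prime ⇒ Promise ⇒ X` (`sandwich`; `promise_of_prime` discharges
  ideator-2's `PrimeToPromiseStub` by ANDing a promise decider with the circuits of `PRIMES` and of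
  `bin {n ≡ 3 (4)}`; `Promise` stated verbatim as ideator-2's `PromiseIqThreeNotPPoly`). (b) the prime `3 ↦ 2`: FORMAL AND UNCONDITIONAL (§3(b) below,
  `iqTwoNotPPoly_iff_fundNotPPoly`): `bin {d | −d fund., 2 ∣ h(−d)} ∉ P/poly ↔ bin {d | −d fund.}
  ∉ P/poly` — Gauss's genus theory `|Cl[2]| = 2^{ω(d)−1}` (tree: `card_sq_eq_one_classGroup`) gives
  `2 ∣ h(−d) ↔ ω(d) ≥ 2 ↔ d ∉ {4, 8} ∪ primes` (`two_dvd_classNumber_iff`,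
  `two_dvd_classNumber_iff_not`, via the PROVED bridge `h(d_K) = h_K` and the existence of a
  quadratic field of each fundamental discriminant), then AKS (`PRIMES_mem_P'`), a two-gate circuit
  family for `bin {n | n ≡ 3 (4)}` (`mod4_mem_PPoly`) and closure of `P/poly` under `⊓, ⊔, ∖`: the
  `ℓ = 2` analogue of X carries NO class-group content beyond recognising fundamental (squarefree)
  discriminants — a factoring-computable task; `ℓ = 3` is the first prime where X can be
  factoring-independent, as the route claims.
  (c) `P/poly ↦ SIZE(s)`: see §4.
* §4 NATURAL STRENGTHENINGS. (a) "IQ3 ∉ SIZE(lupanovBound)" (`≈ 36·2ⁿ/n`) is FALSE: EVERY language is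
  in `SIZE lupanovBound` (`mem_SIZE_lupanovBound`, tree Lupanov + `CktSize.toCircuit`;
  `not_exp_strengthening`). (b) MODEL CAVEAT for anyone stating SIZE bounds: `SIZE s = ∅` whenever
  `s 0 = 0` (`SIZE_eq_empty_of_apply_zero`: a `Circuit (Fin 0)` needs ≥ 1 gate; the same fact is
  already in the tree as `Summit.PneNP.Circuit.SIZE_eq_empty_of_apply_zero`, where it killed the
  literal `SIZE(n^k)` form of a PneNP item), so e.g. `IQ3 ∉ SIZE (fun n => 36 * 2 ^ n / n)` holds
  for the JUNK reason (`not_mem_SIZE_of_apply_zero`).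
  (c) "IQ3 ∉ SIZE(2^{n^{1/2+ε}})" is FALSE UNDER GRH (Hafner–McCurley `L(1/2)` + Adleman; prose, not
  in the tree): S, if true, lives strictly between `poly(n)` and `2^{Õ(√n)}`, like FACT.
  (d) the mutation `3 ∣ h(−d) ↦ h(−d) = 1` is FALSE (`not_iqOneNotPPoly`): by the class number one
  theorem (PROVED in the tree) that language is finite, and finite languages are in `P/poly`
  (`mem_PPoly_of_finite`) — the crux needs a condition with infinitely many fundamental solutions
  even to be non-trivial (for `3 ∣ h`: Nagell 1922; quantitatively Davenport–Heilbronn).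
* §4bis/§4ter ELEMENTARY FACES OF ¬S (data by `decide`): Dirichlet's residue count on primes
  (`2R(p) − (p−1)/2 mod 3·(2 − (2/p))`) and the theta face `r₃(d) = 24 h(−d)` on `d ≡ 3 (8)` — a
  refutation must in particular give small circuits for "#squares below `p/2`, mod 9" or for
  "#representations as three squares, mod 9".
* §5 Targets: none (payload.targets / stuck_stubs empty at cycle 1).

LANDED under `Theorems/IqThreeNotPPoly/Negative/` (importable): `RefutationShape.lean` (p83383:
reading, small models, cost lemmas, natural-proofs no-go, prime core via AKS), `Strengthenings.lean`
(p83499: `mem_SIZE_lupanovBound`, `mem_PPoly_of_finite`, `iqOne_mem_PPoly`); the `ℓ = 2` collapse is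
filed as `GenusTwoParity.lean` + `GenusTwoCollapse.lean` (split after a >400-line bounce).
CRUX ECOSYSTEM: the ideator cards `squarefree-core` / `sqfree-filter-domination` (randomised
`SQUAREFREES ≤ IQ3` through binary cubic forms with a planted divisor / double root) turn §3(a)'s
"bundling" remark into a reduction candidate `SqfNotPPoly ⇒ X`; `exact-decider-top-rung`,
`sign-test-correlation-apex` place X at the apex of the correlation ladder through the promise form;
`mirror-promise-split` (Scholz–Kummer) and `theta-derivation-digit` (`r₃ mod 9`) are the two
reformulations also examined here from the refutation side (§5 prose (B), (D); §4ter).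

WHY IT RESISTS (for the provers/planners): ¬S is an upper bound (an algorithm) — no barrier, just
200 years without one; S is a super-polynomial circuit lower bound for an explicit `P^{#P}` language
— natural-proofs-barred under hard PRGs (§2) and would separate `NP` (printed `IQ3 ∈ NP`) and
`PSPACE` from `P/poly`. Hypothesis-type in both directions; the refuter's standing recommendations
are the restatements of §3(a) (prime/promise form for factoring-independence; `IQ3 ∉ BPP` as the
minimal top the assembly consumes).
-/

noncomputable section

set_option linter.dupNamespace false

namespace Summit.QuantumAdvantage.QuantumAdvantage.Cruxes.IqThreeNotPPoly.Disproof

open _root_.Computability Literature.Computability.Complexity Literature.Computability.Complexity.Classes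
open Literature.Computability.Cryptography Literature.Computability.MetaComplexity
open Literature.Computability.QuantumComplexity (PRIMES PRIMES_mem_P')
open Literature.NumberTheory.QuadraticFields
open Summit.QuantumAdvantage.QuantumAdvantage.Theses.ArithStatLadder
open Filter

/-! ### §0 Reading of the statement -/

/-- The set `S = {d : −d fundamental, 3 ∣ h(−d)}` of the crux (`IsNegFundamentalDiscr` of
`HallgrenClassGroup.lean` is verbatim the route file's inline disjunction). [folklore] -/
def iqThreeSet : Set ℕ :=
  {d | IsNegFundamentalDiscr d ∧ 3 ∣ BinaryQuadraticForm.classNumber (-(d : ℤ))}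

/-- The language `IQ3 = bin(S)` (image of Mathlib's `encodeNat`, LSB first). [folklore] -/
def iqThreeLang : Language Bool :=
  encodingNatBool.toLanguage iqThreeSet

/-- The crux is literally `IQ3 ∉ P/poly` (definitional). [folklore] -/
theorem iqThreeNotPPoly_iff : IqThreeNotPPoly ↔ iqThreeLang ∉ PPoly := Iff.rfl

/-- A refutation is literally `IQ3 ∈ P/poly`. [folklore] -/
theorem not_iqThreeNotPPoly_iff : ¬ IqThreeNotPPoly ↔ iqThreeLang ∈ PPoly := by
  rw [iqThreeNotPPoly_iff, not_not]

/-- … i.e. an explicit polynomial-size `B₂`-circuit family deciding IQ3 on every word. [folklore] -/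
theorem not_iqThreeNotPPoly_iff_exists :
    ¬ IqThreeNotPPoly ↔ ∃ p : Polynomial ℕ, ∃ C : CircuitFamily,
      (∀ n, (C n).IsOver B2 ∧ (C n).size ≤ p.eval n) ∧ C.Decides iqThreeLang := by
  rw [not_iqThreeNotPPoly_iff]
  simp only [PPoly, SIZE, Set.mem_iUnion, Set.mem_setOf_eq]

/-- Membership in the language of an encoded number is membership in `S`. [folklore] -/
theorem encodeNat_mem_iff (d : ℕ) : encodeNat d ∈ iqThreeLang ↔ d ∈ iqThreeSet :=
  encodingNatBool.mem_toLanguage_iff iqThreeSet d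

/-! ### §1 Small models: the language is a genuine, nontrivial language -/

/-- `h(−3) = 1`. [folklore] -/
theorem classNumber_neg_three : BinaryQuadraticForm.classNumber (-3) = 1 := by decide

/-- `h(−4) = 1`. [folklore] -/
theorem classNumber_neg_four : BinaryQuadraticForm.classNumber (-4) = 1 := by decide

/-- `h(−19) = 1`. [folklore] -/
theorem classNumber_neg_nineteen : BinaryQuadraticForm.classNumber (-19) = 1 := by decide

/-- `h(−23) = 3` (the least fundamental discriminant with `3 ∣ h`). [folklore] -/
theorem classNumber_neg_twentythree : BinaryQuadraticForm.classNumber (-23) = 3 := by decide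

/-- `h(−31) = 3`. [folklore] -/
theorem classNumber_neg_thirtyone : BinaryQuadraticForm.classNumber (-31) = 3 := by decide

/-- A prime `p ≡ 3 (mod 4)` gives a fundamental discriminant `−p`. [folklore] -/
theorem isNegFundamentalDiscr_of_prime {p : ℕ} (hp : p.Prime) (h4 : p % 4 = 3) :
    IsNegFundamentalDiscr p := by
  left
  refine ⟨by omega, ?_, by omega⟩
  have h : Prime (-(p : ℤ)) := Int.prime_iff_natAbs_prime.2 (by simpa using hp)
  exact h.squarefree

/-- `0 ∉ S`. [folklore] -/
theorem zero_not_mem : 0 ∉ iqThreeSet := by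
  rintro ⟨h, -⟩
  rcases h with ⟨h1, -, -⟩ | ⟨-, h2, -⟩
  · norm_num at h1
  · norm_num at h2

/-- `3 ∉ S`: `h(−3) = 1`. [folklore] -/
theorem three_not_mem : 3 ∉ iqThreeSet := by
  rintro ⟨-, h⟩
  rw [show (-(((3 : ℕ)) : ℤ)) = -3 by norm_num, classNumber_neg_three] at h
  omega

/-- `4 ∉ S`: `h(−4) = 1`. [folklore] -/
theorem four_not_mem : 4 ∉ iqThreeSet := by
  rintro ⟨-, h⟩
  rw [show (-(((4 : ℕ)) : ℤ)) = -4 by norm_num, classNumber_neg_four] at h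
  omega

/-- `19 ∉ S`: `h(−19) = 1`. [folklore] -/
theorem nineteen_not_mem : 19 ∉ iqThreeSet := by
  rintro ⟨-, h⟩
  rw [show (-(((19 : ℕ)) : ℤ)) = -19 by norm_num, classNumber_neg_nineteen] at h
  omega

/-- `23 ∈ S`: `23` is a prime `≡ 3 (mod 4)` and `h(−23) = 3`. [folklore] -/
theorem twentythree_mem : 23 ∈ iqThreeSet := by
  refine ⟨isNegFundamentalDiscr_of_prime (by norm_num) (by norm_num), ?_⟩
  rw [show (-(((23 : ℕ)) : ℤ)) = -23 by norm_num, classNumber_neg_twentythree]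

/-- `31 ∈ S`: `31` is a prime `≡ 3 (mod 4)` and `h(−31) = 3`. [folklore] -/
theorem thirtyone_mem : 31 ∈ iqThreeSet := by
  refine ⟨isNegFundamentalDiscr_of_prime (by norm_num) (by norm_num), ?_⟩
  rw [show (-(((31 : ℕ)) : ℤ)) = -31 by norm_num, classNumber_neg_thirtyone]

/-- The empty word is not in `IQ3` (it encodes `0`); at length `0` a deciding circuit must output
`false` (one constant gate of arity `0`, which IS in `B₂`). [folklore] -/
theorem nil_not_mem : ([] : List Bool) ∉ iqThreeLang := by
  rintro ⟨d, hd, hd0⟩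
  change encodeNat d = [] at hd0
  have h := congrArg decodeNat hd0
  rw [decode_encodeNat] at h
  have h0 : d = 0 := h.trans (by decide)
  subst h0
  exact zero_not_mem hd

/-- `IQ3 ≠ ∅`. [folklore] -/
theorem lang_ne_zero : iqThreeLang ≠ 0 := by
  intro h
  have h23 : encodeNat 23 ∈ iqThreeLang := (encodeNat_mem_iff 23).2 twentythree_mem
  rw [h] at h23
  exact h23

/-- `IQ3 ≠ {0,1}*`. [folklore] -/
theorem lang_ne_univ : iqThreeLang ≠ (Set.univ : Set (List Bool)) := by
  intro h
  have h3 : encodeNat 3 ∉ iqThreeLang := fun hm => three_not_mem ((encodeNat_mem_iff 3).1 hm)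
  rw [h] at h3
  exact h3 (Set.mem_univ _)

/-- The length-5 slice of `IQ3` is non-constant: `bin 19 = 11001` (LSB first) is out, `bin 23 =
11101` is in. So no slice-constancy shortcut (`SIZE 1`) is available either. [folklore] -/
theorem slice_five_nonconst :
    encodeNat 19 ∉ iqThreeLang ∧ encodeNat 23 ∈ iqThreeLang ∧
      (encodeNat 19).length = 5 ∧ (encodeNat 23).length = 5 :=
  ⟨fun hm => nineteen_not_mem ((encodeNat_mem_iff 19).1 hm),
    (encodeNat_mem_iff 23).2 twentythree_mem, by decide, by decide⟩

/-! ### §2 The refutation interface and the proof interface -/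

/-- ¬S from a polynomial-time algorithm (tree theorem `P ⊆ P/poly`). None is known. [folklore] -/
theorem not_iqThreeNotPPoly_of_mem_P (h : iqThreeLang ∈ P) : ¬ IqThreeNotPPoly :=
  not_iqThreeNotPPoly_iff.2 (P_subset_PPoly_holds h)

/-- ¬S from a bounded-error randomized polynomial-time algorithm (Adleman, tree theorem
`BPP ⊆ P/poly`). None is known. [folklore] -/
theorem not_iqThreeNotPPoly_of_mem_BPP (h : iqThreeLang ∈ BPP) : ¬ IqThreeNotPPoly :=
  not_iqThreeNotPPoly_iff.2 (BPP_subset_PPoly_holds h)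

/-- ¬S from a polynomial-time Turing reduction of IQ3 to any language with polynomial-size
circuits (tree theorem: `P/poly` is closed under `≤ᵀₚ`). [folklore] -/
theorem not_iqThreeNotPPoly_of_turingReducible {A : Language Bool}
    (h : PolyTimeTuringReducible iqThreeLang A) (hA : A ∈ PPoly) : ¬ IqThreeNotPPoly :=
  not_iqThreeNotPPoly_iff.2 (mem_PPoly_of_polyTimeTuringReducible h hA)

/-- ¬S from a Karp reduction of IQ3 to a language with polynomial-size circuits. [folklore] -/
theorem not_iqThreeNotPPoly_of_karpReducible {A : Language Bool}
    (h : PolyTimeKarpReducible iqThreeLang A) (hA : A ∈ PPoly) : ¬ IqThreeNotPPoly :=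
  not_iqThreeNotPPoly_iff.2 (mem_PPoly_of_karpReducible h hA)

/-- S puts IQ3 outside `BPP` (Adleman). [folklore] -/
theorem not_mem_BPP_of (h : IqThreeNotPPoly) : iqThreeLang ∉ BPP :=
  fun hB => h (BPP_subset_PPoly_holds hB)

/-- S puts IQ3 outside `P`. [folklore] -/
theorem not_mem_P_of (h : IqThreeNotPPoly) : iqThreeLang ∉ P :=
  fun hP => h (P_subset_PPoly_holds hP)

/-- The summit needs only the UNIFORM statement `IQ3 ∉ BPP` next to `IqThreeMemBQP`
(definition of `QuantumAdvantage`). [folklore] -/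
theorem quantumAdvantage_of_not_mem_BPP (hQ : IqThreeMemBQP) (hB : iqThreeLang ∉ BPP) :
    QuantumAdvantage :=
  ⟨iqThreeLang, hQ, hB⟩

/-- … so the route's deciding theorem factors through `not_mem_BPP_of`: X = `IQ3 ∉ P/poly` is
stronger than what the assembly consumes. [folklore] -/
theorem quantumAdvantage_of (hQ : IqThreeMemBQP) (hX : IqThreeNotPPoly) : QuantumAdvantage :=
  quantumAdvantage_of_not_mem_BPP hQ (not_mem_BPP_of hX)

/-- Even the MINIMAL uniform top `IQ3 ∉ BPP` is separation-strength: with the printed `IQ3 ∈ NP`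
it gives `P ≠ NP` (tree theorem `P ⊆ BPP`). So weakening X to the uniform statement removes the
natural-proofs barrier (§2 below) but not the separation prerequisite. [folklore] -/
theorem P_ne_NP_of_not_mem_BPP (hB : iqThreeLang ∉ BPP) (hNP : iqThreeLang ∈ Nondeterministic.NP) :
    (P : Set (Language Bool)) ≠ Nondeterministic.NP :=
  fun hEq => hB (P_subset_BPP_holds (hEq ▸ hNP))

/-- Why S is hypothesis-type: with the folklore membership `IQ3 ∈ PSPACE` (count reduced forms in
polynomial space; not constructed in the tree) S separates `PSPACE` from `P/poly`. [folklore] -/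
theorem PSPACE_not_subset_PPoly_of (h : IqThreeNotPPoly) (hS : iqThreeLang ∈ PSPACE) :
    ¬ PSPACE ⊆ PPoly :=
  fun hsub => h (hsub hS)

/-- Sharper: `IQ3 ∈ NP` is a theorem in print (YES-witness for `3 ∣ h(D)`, `D` fundamental: an
irreducible integral binary cubic form of discriminant `D` — Hasse 1930 / Delone–Faddeev /
Davenport–Heilbronn; fundamentality by a certified factorisation, Pratt) though not in the tree;
with it, S already separates `NP` from `P/poly` (so proving S proves `P ≠ NP`). The ideator cards
`squarefree-core` / `sqfree-filter-domination` use the same witnesses. [folklore] -/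
theorem NP_not_subset_PPoly_of (h : IqThreeNotPPoly) (hNP : iqThreeLang ∈ Nondeterministic.NP) :
    ¬ Nondeterministic.NP ⊆ PPoly :=
  fun hsub => h (hsub hNP)

/-- … in particular `P ≠ NP` would follow (tree theorem `P ⊆ P/poly`). [folklore] -/
theorem P_ne_NP_of (h : IqThreeNotPPoly) (hNP : iqThreeLang ∈ Nondeterministic.NP) :
    (P : Set (Language Bool)) ≠ Nondeterministic.NP :=
  fun hEq => not_mem_P_of h (hEq ▸ hNP)

/-- **Natural-proofs barrier, instantiated at IQ3**: under Razborov–Rudich Thm 4.1 (catalogue fact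
`Literature.Barriers.QuantumAdvantage.NaturalProofs`) and `2^{k^ε}`-hard PRGs in `P/poly`, no
natural property contains the slices of IQ3 infinitely often. [folklore] -/
theorem no_naturalProof_iqThree (hRR : Literature.Barriers.QuantumAdvantage.NaturalProofs)
    (hG : Literature.Barriers.PneNP.HardPRGExist) :
    ¬ ∃ Q : CombinatorialProperty, Literature.Barriers.PneNP.IsNaturalProof Q ∧
      ∃ᶠ n in atTop, iqThreeLang.sliceFn n ∈ Q n :=
  Literature.Barriers.PneNP.NaturalProofs.no_naturalProof_for hRR hG iqThreeLang

/-- … whereas such a natural property WOULD prove S (usefulness in language form, tree fact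
`isUsefulAgainst_PPoly_of_isUsefulAgainstPPoly`, discharged in `NaturalProofsProofs.lean`).
[folklore] -/
theorem iqThreeNotPPoly_of_naturalProof (huse : isUsefulAgainst_PPoly_of_isUsefulAgainstPPoly)
    {Q : CombinatorialProperty} (hQ : Literature.Barriers.PneNP.IsNaturalProof Q)
    (hF : ∃ᶠ n in atTop, iqThreeLang.sliceFn n ∈ Q n) : IqThreeNotPPoly :=
  iqThreeNotPPoly_iff.2 (hQ.not_mem_PPoly huse hF)

/-! ### §3 Load-bearing analysis -/

/-- (a) Off the discriminants the tree's `h` vanishes: `h(−d) = 0` for `d ≡ 1, 2 (mod 4)`, `d > 0`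
(no form has discriminant `≢ 0, 1 (mod 4)`). [folklore] -/
theorem classNumber_eq_zero_of_mod_four {d : ℕ} (hd : 0 < d) (h : d % 4 = 1 ∨ d % 4 = 2) :
    BinaryQuadraticForm.classNumber (-(d : ℤ)) = 0 := by
  unfold BinaryQuadraticForm.classNumber
  rw [BinaryQuadraticForm.reducedForms_eq_empty (by omega) (by omega), Finset.card_empty]

/-- Hence `3 ∣ h(−d)` holds VACUOUSLY there: dropping the fundamentality conjunct changes the
language by adding all of `{d ≡ 1, 2 (mod 4)}`. [folklore] -/
theorem three_dvd_classNumber_of_not_discr {d : ℕ} (hd : 0 < d) (h : d % 4 = 1 ∨ d % 4 = 2) :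
    3 ∣ BinaryQuadraticForm.classNumber (-(d : ℤ)) := by
  rw [classNumber_eq_zero_of_mod_four hd h]
  exact dvd_zero 3

/-- The crux WITHOUT the fundamentality conjunct (orders of discriminant `−d` for `d ≡ 0, 3 (4)`,
and junk-membership of every `d ≡ 1, 2 (4)`). Not refutable either (again an explicit algorithm
would be needed); recorded to pin down what the conjunct does. [folklore] -/
def IqThreeNotPPolyWithoutFund : Prop :=
  encodingNatBool.toLanguage {d : ℕ | 3 ∣ BinaryQuadraticForm.classNumber (-(d : ℤ))} ∉ PPoly

/-- Every positive `d ≡ 1, 2 (mod 4)` lies in the set of `IqThreeNotPPolyWithoutFund`. [folklore] -/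
theorem mem_withoutFund_of_mod_four {d : ℕ} (hd : 0 < d) (h : d % 4 = 1 ∨ d % 4 = 2) :
    d ∈ {d : ℕ | 3 ∣ BinaryQuadraticForm.classNumber (-(d : ℤ))} :=
  three_dvd_classNumber_of_not_discr hd h

/-- For a PRIME `p`, `−p` is fundamental iff `p ≡ 3 (mod 4)` (the `4 ∣ −p` branch is void).
[folklore] -/
theorem mod_four_of_isNegFundamentalDiscr_of_prime {p : ℕ} (hF : IsNegFundamentalDiscr p)
    (hp : p.Prime) : p % 4 = 3 := by
  rcases hF with ⟨h1, -, -⟩ | ⟨h4, -, -⟩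
  · omega
  · exfalso
    have h4' : (4 : ℕ) ∣ p := by exact_mod_cast (Int.dvd_neg.1 h4)
    rcases hp.eq_one_or_self_of_dvd 4 h4' with h | h
    · omega
    · subst h
      norm_num at hp

/-- The factoring-free core of the crux: primes `p ≡ 3 (mod 4)` with `3 ∣ h(−p)`. [folklore] -/
def primeIqThreeSet : Set ℕ :=
  {p | p.Prime ∧ p % 4 = 3 ∧ 3 ∣ BinaryQuadraticForm.classNumber (-(p : ℤ))}

/-- `IQ3′ = bin(primeIqThreeSet)`. [folklore] -/
def primeIqThreeLang : Language Bool := encodingNatBool.toLanguage primeIqThreeSet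

/-- **Prime version of the crux** (planner note: the honest factoring-independent top rung — no
squarefree recognition is bundled, primality being in `P` by AKS, PROVED in the tree):
`IQ3′ ∉ P/poly`. [folklore] -/
def PrimeIqThreeNotPPoly : Prop := primeIqThreeLang ∉ PPoly

/-- `primeIqThreeSet = S ∩ PRIMES-set`. [folklore] -/
theorem primeIqThreeSet_eq : primeIqThreeSet = iqThreeSet ∩ {p | p.Prime} := by
  ext p
  constructor
  · rintro ⟨hp, h4, h3⟩
    exact ⟨⟨isNegFundamentalDiscr_of_prime hp h4, h3⟩, hp⟩
  · rintro ⟨⟨hF, h3⟩, hp⟩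
    exact ⟨hp, mod_four_of_isNegFundamentalDiscr_of_prime hF hp, h3⟩

/-- `bin` commutes with intersections (injectivity of `encodeNat`). [folklore] -/
theorem toLanguage_inter (A B : Set ℕ) :
    encodingNatBool.toLanguage (A ∩ B) = encodingNatBool.toLanguage A ⊓ encodingNatBool.toLanguage B :=
  Set.image_inter encodingNatBool.encode_injective

/-- `IQ3′ = IQ3 ⊓ PRIMES` (the tree's `PRIMES = bin {p | p.Prime}`). [folklore] -/
theorem primeIqThreeLang_eq : primeIqThreeLang = iqThreeLang ⊓ PRIMES := by
  rw [primeIqThreeLang, primeIqThreeSet_eq, toLanguage_inter]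
  rfl

/-- **A refutation of the crux refutes the prime version as well** — UNCONDITIONALLY: `PRIMES ∈ P`
(AKS, tree theorem `PRIMES_mem_P'`) `⊆ P/poly`, and `P/poly` is closed under `⊓`
(`inter_mem_PPoly`). [folklore] -/
theorem not_prime_of_not (h : ¬ IqThreeNotPPoly) : ¬ PrimeIqThreeNotPPoly := by
  rw [PrimeIqThreeNotPPoly, not_not, primeIqThreeLang_eq]
  exact Literature.Computability.AlgebraicComplexity.inter_mem_PPoly (not_iqThreeNotPPoly_iff.1 h)
    (P_subset_PPoly_holds PRIMES_mem_P')

/-- Contrapositive: **the prime version implies the crux** (in-tree, hypothesis-free). The full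
sandwich is `Prime ⇒ Promise ⇒ X` (`Promise` = "no poly-size family computes `[3 ∣ h(−d)]` on every
fundamental `−d`", ideator-2's `PromiseIqThreeNotPPoly`, with `Promise ⇒ X` kernel-checked in
`SketchIdeator2.lean`); its remaining stub `PrimeToPromiseStub` is now dischargeable WITHOUT
hypotheses: AND a promise decider with the circuits of `PRIMES` (`PRIMES_mem_P'` + `P ⊆ P/poly`) and of
`bin {n ≡ 3 (4)}` (`mod4_mem_PPoly`, §3(b)). [folklore] -/
theorem iqThreeNotPPoly_of_prime (h : PrimeIqThreeNotPPoly) : IqThreeNotPPoly :=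
  fun hS => not_prime_of_not (not_iqThreeNotPPoly_iff.2 hS) h

/-! ### §4 Natural strengthenings -/

/-- **Every language has circuits of Lupanov size** (`lupanovBound n`, `≤ 36·2ⁿ/n` for `n ≥ 1`;
tree theorem `cktSize_lupanov`): `L ∈ SIZE lupanovBound` for every `L`. [folklore] -/
theorem mem_SIZE_lupanovBound (L : Language Bool) : L ∈ SIZE lupanovBound := by
  classical
  have key : ∀ n, ∃ C : Circuit (Fin n), C.IsOver B2 ∧ C.size ≤ lupanovBound n ∧
      ∀ x, C.eval x = L.boolIndicator (List.ofFn x) := fun n =>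
    (cktSize_lupanov (n := n) fun v (_ : Unit) => L.boolIndicator (List.ofFn v)).toCircuit
  choose C hC using key
  refine ⟨C, fun n => ⟨(hC n).1, (hC n).2.1⟩, fun x => ?_⟩
  rw [(hC x.length).2.2, List.ofFn_get]

/-- So the exponential strengthening "IQ3 ∉ SIZE(lupanovBound)" of the crux is FALSE. [folklore] -/
theorem not_exp_strengthening : ¬ (iqThreeLang ∉ SIZE lupanovBound) :=
  not_not.2 (mem_SIZE_lupanovBound iqThreeLang)

/-- MODEL CAVEAT: a size bound vanishing at length `0` defines the EMPTY class — a
`Circuit (Fin 0)` has no input wire to output, so it needs at least one gate. [folklore] -/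
theorem SIZE_eq_empty_of_apply_zero {s : ℕ → ℕ} (h : s 0 = 0) : SIZE s = ∅ := by
  ext L
  simp only [Set.mem_empty_iff_false, iff_false]
  rintro ⟨C, hC, -⟩
  have hsz : (C 0).size = 0 := by
    have h0 := (hC 0).2
    rw [h] at h0
    exact Nat.le_zero.1 h0
  rcases hout : (C 0).output with i | m
  · exact i.elim0
  · have hm := (C 0).wf_output m hout
    simp only [Circuit.size] at hsz
    omega

/-- … so e.g. `IQ3 ∉ SIZE (fun n => 36 * 2 ^ n / n)` holds, for the junk reason `36 * 1 / 0 = 0`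
(and so does `L ∉ …` for every `L`): state SIZE bounds with `s 0 ≥ 1`. [folklore] -/
theorem not_mem_SIZE_of_apply_zero (L : Language Bool) {s : ℕ → ℕ} (h : s 0 = 0) : L ∉ SIZE s := by
  rw [SIZE_eq_empty_of_apply_zero h]
  exact Set.notMem_empty L

/-- Instance of the caveat. [folklore] -/
theorem iqThree_not_mem_SIZE_junk : iqThreeLang ∉ SIZE (fun n => 36 * 2 ^ n / n) :=
  not_mem_SIZE_of_apply_zero iqThreeLang (by decide)

/-- **Finite languages have bounded-size circuit families** (Lupanov below the length bound,
one constant gate above it), hence lie in `P/poly`. [folklore] -/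
theorem mem_PPoly_of_finite {L : Language Bool} (hL : (L : Set (List Bool)).Finite) : L ∈ PPoly := by
  classical
  -- a bound on the lengths of the members of `L`
  obtain ⟨N, hN⟩ : ∃ N, ∀ x ∈ L, x.length ≤ N := by
    refine ⟨(hL.toFinset.image List.length).sup id, fun x hx => ?_⟩
    have hx' : x.length ∈ hL.toFinset.image List.length :=
      Finset.mem_image_of_mem _ (hL.mem_toFinset.2 hx)
    exact Finset.le_sup (f := id) hx'
  -- circuits: Lupanov for short lengths, the constant `false` above `N`
  have keyS : ∀ n, ∃ C : Circuit (Fin n), C.IsOver B2 ∧ C.size ≤ lupanovBound n ∧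
      ∀ x, C.eval x = L.boolIndicator (List.ofFn x) := fun n =>
    (cktSize_lupanov (n := n) fun v (_ : Unit) => L.boolIndicator (List.ofFn v)).toCircuit
  have keyL : ∀ n, ∃ C : Circuit (Fin n), C.IsOver B2 ∧ C.size ≤ 1 ∧ ∀ x, C.eval x = false :=
    fun n => (cktSize_const (Fin n) false).toCircuit
  choose CS hCS using keyS
  choose CL hCL using keyL
  set M : ℕ := (Finset.range (N + 1)).sup lupanovBound + 1 with hM
  refine Set.mem_iUnion.2 ⟨Polynomial.C M, fun n => if n ≤ N then CS n else CL n,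
    fun n => ?_, fun x => ?_⟩
  · by_cases hn : n ≤ N
    · simp only [hn, if_true, Polynomial.eval_C]
      refine ⟨(hCS n).1, (hCS n).2.1.trans ?_⟩
      have : lupanovBound n ≤ (Finset.range (N + 1)).sup lupanovBound :=
        Finset.le_sup (f := lupanovBound) (Finset.mem_range.2 (Nat.lt_succ_of_le hn))
      omega
    · simp only [hn, if_false, Polynomial.eval_C]
      exact ⟨(hCL n).1, (hCL n).2.1.trans (by omega)⟩
  · show (if x.length ≤ N then CS x.length else CL x.length).eval x.get = L.boolIndicator x
    by_cases hx : x.length ≤ N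
    · simp only [hx, if_true]
      rw [(hCS x.length).2.2, List.ofFn_get]
    · simp only [hx, if_false]
      rw [(hCL x.length).2.2]
      have hxL : x ∉ L := fun h => hx (hN x h)
      exact ((L.notMem_iff_boolIndicator x).1 hxL).symm

/-- (d) The mutation `3 ∣ h(−d) ↦ h(−d) = 1`: the class-number-ONE set. [folklore] -/
def iqOneSet : Set ℕ :=
  {d | IsNegFundamentalDiscr d ∧ BinaryQuadraticForm.classNumber (-(d : ℤ)) = 1}

/-- The mutated crux "the class-number-one language has no polynomial-size circuits". [folklore] -/
def IqOneNotPPoly : Prop := encodingNatBool.toLanguage iqOneSet ∉ PPoly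

/-- By the class number one theorem (Heegner–Stark–Baker; PROVED in the tree,
`mem_classNumberOneDiscrs_of_classNumber_eq_one_holds`) the class-number-one set is bounded by
`163`. [folklore] -/
theorem iqOneSet_subset : iqOneSet ⊆ Set.Iic 163 := by
  rintro d ⟨hF, h1⟩
  have hd4 : 0 < d ∧ ((-(d : ℤ)) % 4 = 0 ∨ (-(d : ℤ)) % 4 = 1) := by
    rcases hF with ⟨h1', -, -⟩ | ⟨h4, h2, -⟩
    · exact ⟨by omega, Or.inr h1'⟩
    · refine ⟨?_, Or.inl (Int.emod_eq_zero_of_dvd h4)⟩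
      rcases Nat.eq_zero_or_pos d with rfl | hd
      · norm_num at h2
      · exact hd
  have hmem := BinaryQuadraticForm.mem_classNumberOneDiscrs_of_classNumber_eq_one_holds
    (-(d : ℤ)) (by omega) hd4.2 h1
  have key : ∀ D ∈ BinaryQuadraticForm.classNumberOneDiscrs, -163 ≤ D := by decide
  have h163 := key _ hmem
  show d ≤ 163
  omega

/-- **The `h = 1` mutation is FALSE**: a finite language is in `P/poly`. So the crux needs a
condition with infinitely many fundamental solutions (for `3 ∣ h(−d)`: Nagell 1922 / the
Davenport–Heilbronn mean) even to escape triviality — divisibility, not smallness, of `h` is what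
carries it. [folklore] -/
theorem not_iqOneNotPPoly : ¬ IqOneNotPPoly := by
  rw [IqOneNotPPoly, not_not]
  exact mem_PPoly_of_finite (((Set.finite_Iic 163).subset iqOneSet_subset).image _)

/-! ### §3(b) The `ℓ = 2` analogue collapses to fundamentality recognition (genus theory, formal)

The residue language `bin {n | n % 4 = 3}` first (two gates per length), then Gauss's genus theory
read as a statement about `P/poly`. -/

section GenusTwo

open Module NumberField

/-- `bitsToNat` of a word of length `≤ 1` is `≤ 1`. [folklore] -/
theorem bitsToNat_le_one_of_length_le_one : ∀ {l : List Bool}, l.length ≤ 1 → bitsToNat l ≤ 1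
  | [], _ => by simp [bitsToNat]
  | [b], _ => by cases b <;> simp [bitsToNat]
  | _ :: _ :: _, h => by simp at h

/-- `bitsToNat (a :: b :: r) % 4 = 3 ↔ a ∧ b`. [folklore] -/
theorem bitsToNat_cons_cons_mod_four (a b : Bool) (r : List Bool) :
    bitsToNat (a :: b :: r) % 4 = 3 ↔ a = true ∧ b = true := by
  simp only [bitsToNat]
  cases a <;> cases b <;> simp <;> omega

/-- Membership of a word in `bin {n | n % 4 = 3}`: canonical (last bit `true`), length `≥ 2`,
and the two lowest bits `true`. Stated for words `a :: b :: r`. [folklore] -/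
theorem cons_cons_mem_iff (a b : Bool) (r : List Bool) :
    (a :: b :: r) ∈ encodingNatBool.toLanguage {n : ℕ | n % 4 = 3} ↔
      (a :: b :: r).getLast? = some true ∧ a = true ∧ b = true := by
  constructor
  · rintro ⟨n, hn, hl⟩
    change encodeNat n = a :: b :: r at hl
    have hcan : IsCanonicalNum (a :: b :: r) := hl ▸ isCanonicalNum_encodeNat n
    have hval : bitsToNat (a :: b :: r) = n := by rw [← hl, bitsToNat_encodeNat]
    refine ⟨hcan.resolve_left (by simp), ?_⟩
    rw [← bitsToNat_cons_cons_mod_four, hval]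
    exact hn
  · rintro ⟨hlast, ha, hb⟩
    have hcan : IsCanonicalNum (a :: b :: r) := Or.inr hlast
    refine ⟨decodeNat (a :: b :: r), ?_, encodeNat_decodeNat hcan⟩
    show decodeNat (a :: b :: r) % 4 = 3
    have hval : bitsToNat (a :: b :: r) = decodeNat (a :: b :: r) := by
      conv_lhs => rw [← encodeNat_decodeNat hcan]
      exact bitsToNat_encodeNat _
    rw [← hval, bitsToNat_cons_cons_mod_four]
    exact ⟨ha, hb⟩

/-- Words of length `≤ 1` are not in `bin {n | n % 4 = 3}` (their value is `≤ 1`). [folklore] -/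
theorem not_mem_of_length_le_one {l : List Bool} (hl : l.length ≤ 1) :
    l ∉ encodingNatBool.toLanguage {n : ℕ | n % 4 = 3} := by
  rintro ⟨n, hn, hln⟩
  change encodeNat n = l at hln
  have h1 : n ≤ 1 := by
    have := bitsToNat_le_one_of_length_le_one hl
    rwa [← hln, bitsToNat_encodeNat] at this
  change n % 4 = 3 at hn
  omega

/-- The slice of `bin {n | n % 4 = 3}` at length `m + 2`, as a Boolean function: last bit and the
two lowest bits. [folklore] -/
theorem boolIndicator_ofFn (m : ℕ) (x : Fin (m + 2) → Bool) :
    (encodingNatBool.toLanguage {n : ℕ | n % 4 = 3}).boolIndicator (List.ofFn x) =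
      (x (Fin.last (m + 1)) && (x 0 && x 1)) := by
  have hof : List.ofFn x = x 0 :: x 1 :: List.ofFn (fun i : Fin m => x i.succ.succ) := by
    rw [List.ofFn_succ, List.ofFn_succ]
    rfl
  have hlast : (List.ofFn x).getLast? = some (x (Fin.last (m + 1))) := by
    rw [List.getLast?_eq_getLast_of_ne_nil (by simp), List.getLast_ofFn_succ]
  apply Bool.eq_iff_iff.2
  rw [← Set.mem_iff_boolIndicator]
  change List.ofFn x ∈ encodingNatBool.toLanguage {n : ℕ | n % 4 = 3} ↔ _
  rw [hof, cons_cons_mem_iff, ← hof, hlast]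
  simp only [Option.some.injEq, Bool.and_eq_true]

/-- **`bin {n | n % 4 = 3} ∈ P/poly`**: two `∧`-gates per length (`x_{m+1} ∧ (x₀ ∧ x₁)` at length
`m + 2`, the constant `false` at lengths `0, 1`). [folklore] -/
theorem mod4_mem_PPoly : encodingNatBool.toLanguage {n : ℕ | n % 4 = 3} ∈ PPoly := by
  classical
  set L := encodingNatBool.toLanguage {n : ℕ | n % 4 = 3} with hL
  have keyS : ∀ m, ∃ C : Circuit (Fin (m + 2)), C.IsOver B2 ∧ C.size ≤ 2 ∧
      ∀ x, C.eval x = L.boolIndicator (List.ofFn x) := fun m => by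
    have h1 : CktSize B2 (fun (x : Fin (m + 2) → Bool) (_ : Unit) => (x 0 && x 1)) 1 :=
      cktSize_and 0 1
    have h2 := ((CktSize.id B2).pair h1).comp
      (cktSize_and (ι := Fin (m + 2) ⊕ Unit) (Sum.inl (Fin.last (m + 1))) (Sum.inr ()))
    have h3 : CktSize B2
        (fun (x : Fin (m + 2) → Bool) (_ : Unit) => L.boolIndicator (List.ofFn x)) 2 :=
      (h2.of_le (by norm_num)).congr fun x u => by
        simp only [Sum.elim_inl, Sum.elim_inr]
        rw [hL, boolIndicator_ofFn]
    exact h3.toCircuit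
  have keyL : ∀ n, ∃ C : Circuit (Fin n), C.IsOver B2 ∧ C.size ≤ 1 ∧ ∀ x, C.eval x = false :=
    fun n => (cktSize_const (Fin n) false).toCircuit
  choose CS hCS using keyS
  choose CL hCL using keyL
  let C : CircuitFamily := fun n => match n with
    | 0 => CL 0
    | 1 => CL 1
    | m + 2 => CS m
  refine Set.mem_iUnion.2 ⟨Polynomial.C 2, C, fun n => ?_, fun x => ?_⟩
  · simp only [Polynomial.eval_C]
    match n with
    | 0 => exact ⟨(hCL 0).1, (hCL 0).2.1.trans one_le_two⟩
    | 1 => exact ⟨(hCL 1).1, (hCL 1).2.1.trans one_le_two⟩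
    | m + 2 => exact ⟨(hCS m).1, (hCS m).2.1⟩
  · match x with
    | [] =>
      show (CL 0).eval _ = _
      rw [(hCL 0).2.2]
      exact ((L.notMem_iff_boolIndicator _).1 (not_mem_of_length_le_one (by simp))).symm
    | [a] =>
      show (CL 1).eval _ = _
      rw [(hCL 1).2.2]
      exact ((L.notMem_iff_boolIndicator _).1 (not_mem_of_length_le_one (by simp))).symm
    | a :: b :: r =>
      show (CS r.length).eval _ = _
      rw [(hCS r.length).2.2, List.ofFn_get]

/-! ### Genus theory: parity of the class number of an imaginary quadratic field -/

section Field

variable {K : Type*} [Field K] [NumberField K]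

/-- `|Cl_K[2]| = 2^{t−1}` for a quadratic field with negative discriminant (the tree's
`card_sq_eq_one_classGroup`, with the hypotheses `[K:ℚ] = 2`, `d_K < 0` in place of
`IsImaginaryQuadratic K`). [folklore] -/
theorem card_sq_eq_one_of_discr_neg (h2 : finrank ℚ K = 2) (hneg : NumberField.discr K < 0) :
    Nat.card {c : ClassGroup (𝓞 K) // c ^ 2 = 1} =
      2 ^ ((NumberField.discr K).natAbs.primeFactors.card - 1) := by
  obtain ⟨b, hb⟩ := Quadratic.exists_basis_zero_eq_one (K := K) h2
  have hω := Quadratic.basis_one_mul_self_eq b hb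
  have hDK := Quadratic.discr_eq_sq_add_four_mul b hb
  have hneg' : (b.repr (b 1 * b 1) 1) ^ 2 + 4 * b.repr (b 1 * b 1) 0 < 0 := hDK ▸ hneg
  rw [Quadratic.card_sq_eq_one_eq_card_filter_ambiguous b hb hω hneg', ← hDK]
  exact Quadratic.card_filter_ambiguous_reducedForms_discr h2 hneg

/-- **Parity of the class number** of a quadratic field with `d_K < 0`: `h_K` is even iff `d_K`
has at least two prime divisors (Gauss's genus theory: `|Cl_K[2]| = 2^{t−1}`, plus Cauchy).
[folklore] -/
theorem two_dvd_card_classGroup_iff (h2 : finrank ℚ K = 2) (hneg : NumberField.discr K < 0) :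
    2 ∣ Fintype.card (ClassGroup (𝓞 K)) ↔ 2 ≤ (NumberField.discr K).natAbs.primeFactors.card := by
  have hc := card_sq_eq_one_of_discr_neg h2 hneg
  haveI : Fact (Nat.Prime 2) := ⟨Nat.prime_two⟩
  constructor
  · intro hdvd
    by_contra hlt
    have ht : (NumberField.discr K).natAbs.primeFactors.card - 1 = 0 := by omega
    rw [ht, pow_zero] at hc
    obtain ⟨x, hx⟩ := exists_prime_orderOf_dvd_card 2 hdvd
    have hx2 : x ^ 2 = 1 := by rw [← hx]; exact pow_orderOf_eq_one x
    have hsub := (Nat.card_eq_one_iff_unique.1 hc).1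
    have h1 : (⟨x, hx2⟩ : {c : ClassGroup (𝓞 K) // c ^ 2 = 1}) = ⟨1, one_pow 2⟩ :=
      Subsingleton.elim _ _
    have hx1 : x = 1 := congrArg Subtype.val h1
    rw [hx1, orderOf_one] at hx
    exact absurd hx (by norm_num)
  · intro ht
    have h2le : 1 < Nat.card {c : ClassGroup (𝓞 K) // c ^ 2 = 1} := by
      rw [hc]
      calc 1 < 2 ^ 1 := by norm_num
        _ ≤ 2 ^ ((NumberField.discr K).natAbs.primeFactors.card - 1) :=
          Nat.pow_le_pow_right (by norm_num) (by omega)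
    haveI := Finite.one_lt_card_iff_nontrivial.1 h2le
    obtain ⟨a, b, hab⟩ := exists_pair_ne {c : ClassGroup (𝓞 K) // c ^ 2 = 1}
    obtain ⟨c, hc1⟩ : ∃ c : {c : ClassGroup (𝓞 K) // c ^ 2 = 1}, c.1 ≠ 1 := by
      by_cases ha : a.1 = 1
      · exact ⟨b, fun hb1 => hab (Subtype.ext (ha.trans hb1.symm))⟩
      · exact ⟨a, ha⟩
    have hord : orderOf c.1 = 2 := orderOf_eq_prime c.2 hc1
    rw [← hord]
    exact orderOf_dvd_card

end Field

/-! ### Form level: `2 ∣ h(−d)` for fundamental `−d` -/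

/-- A negative fundamental discriminant `−d` has `d > 0`. [folklore] -/
theorem pos_of_isNegFundamentalDiscr {d : ℕ} (hF : IsNegFundamentalDiscr d) : 0 < d := by
  rcases hF with ⟨h1, -, -⟩ | ⟨-, h2, -⟩
  · omega
  · rcases Nat.eq_zero_or_pos d with rfl | hd
    · norm_num at h2
    · exact hd

/-- **`2 ∣ h(−d)` iff `d` has at least two prime factors**, for a fundamental `−d` (genus
theory through the tree's `card_sq_eq_one_classGroup`, the PROVED bridge `h(d_K) = h_K` and the
existence of a quadratic field of every fundamental discriminant). [folklore] -/
theorem two_dvd_classNumber_iff {d : ℕ} (hF : IsNegFundamentalDiscr d) :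
    2 ∣ BinaryQuadraticForm.classNumber (-(d : ℤ)) ↔ 2 ≤ d.primeFactors.card := by
  obtain ⟨K, _, _, h2, hdisc⟩ := Quadratic.exists_numberField_discr_eq (D := -(d : ℤ)) hF
  have hd0 := pos_of_isNegFundamentalDiscr hF
  have hneg : NumberField.discr K < 0 := by rw [hdisc]; omega
  have hbridge := Quadratic.card_reducedForms_eq_classNumber h2 hneg
  rw [hdisc] at hbridge
  rw [hbridge, NumberField.classNumber, two_dvd_card_classGroup_iff h2 hneg, hdisc,
    Int.natAbs_neg, Int.natAbs_natCast]

/-- For fundamental `−d`: `d` has at most one prime factor iff `d ∈ {4, 8}` or `d` is prime.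
[folklore] -/
theorem card_primeFactors_le_one_iff {d : ℕ} (hF : IsNegFundamentalDiscr d) :
    d.primeFactors.card ≤ 1 ↔ d = 4 ∨ d = 8 ∨ d.Prime := by
  have hd0 := pos_of_isNegFundamentalDiscr hF
  constructor
  · intro h
    have hd1 : 1 < d := by
      rcases hF with ⟨h1, -, h3⟩ | ⟨h4, -, -⟩ <;> omega
    have hcard : d.primeFactors.card = 1 := by
      have : 0 < d.primeFactors.card :=
        Finset.card_pos.2 (Nat.nonempty_primeFactors.2 hd1)
      omega
    obtain ⟨p, k, hp, hk, hpk⟩ :=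
      (isPrimePow_iff_card_primeFactors_eq_one.2 hcard)
    have hp' : p.Prime := hp.nat_prime
    rcases hF with ⟨h1, hsq, -⟩ | ⟨h4, hm4, hsq⟩
    · -- odd case: `d = p^k` squarefree, so `k = 1`
      right; right
      have hsqN : Squarefree (p ^ k) := by
        rw [hpk]; rwa [← Int.squarefree_natAbs, Int.natAbs_neg, Int.natAbs_natCast] at hsq
      rcases Squarefree.eq_zero_or_one_of_pow_of_not_isUnit hsqN
          (fun hu => hp'.one_lt.ne' (Nat.isUnit_iff.1 hu)) with hk0 | hk1
      · omega
      · rw [← hpk, hk1, pow_one]; exact hp'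
    · -- even case: `p = 2`, `d = 2^k`, `d/4 = 2^(k-2)` squarefree, so `k ∈ {2, 3}`
      have h4d : 4 ∣ d := by exact_mod_cast (Int.dvd_neg.1 h4)
      have h2p : p = 2 := by
        have h2d : 2 ∣ p ^ k := hpk ▸ (dvd_trans (by norm_num) h4d)
        exact ((Nat.prime_dvd_prime_iff_eq Nat.prime_two hp').1
          (Nat.prime_two.dvd_of_dvd_pow h2d)).symm
      subst h2p
      have hk2 : 2 ≤ k := by
        by_contra hk2
        interval_cases k
        rw [pow_one] at hpk
        omega
      obtain ⟨j, rfl⟩ : ∃ j, k = j + 2 := ⟨k - 2, by omega⟩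
      have hdk : (d : ℤ) = 4 * 2 ^ j := by
        rw [← hpk]; push_cast; rw [pow_add]; ring
      have hdiv : (-(d : ℤ)) / 4 = -(2 ^ j) := by rw [hdk]; omega
      rw [hdiv] at hsq
      have hsqN : Squarefree ((2 : ℕ) ^ j) := by
        rw [← Int.squarefree_natAbs] at hsq
        have habs : (-((2 : ℤ) ^ j)).natAbs = 2 ^ j := by simp [Int.natAbs_pow]
        rwa [habs] at hsq
      rcases Squarefree.eq_zero_or_one_of_pow_of_not_isUnit hsqN
          (fun hu => absurd (Nat.isUnit_iff.1 hu) (by norm_num)) with hj0 | hj1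
      · left; rw [← hpk, hj0]; norm_num
      · right; left; rw [← hpk, hj1]; norm_num
  · rintro (rfl | rfl | hp)
    · rw [show (4 : ℕ) = 2 ^ 2 by norm_num, Nat.primeFactors_prime_pow two_ne_zero Nat.prime_two]
      simp
    · rw [show (8 : ℕ) = 2 ^ 3 by norm_num, Nat.primeFactors_prime_pow three_ne_zero Nat.prime_two]
      simp
    · rw [hp.primeFactors, Finset.card_singleton]

/-- **Genus theory for the `ℓ = 2` analogue of the crux**: on fundamental `−d`,
`2 ∣ h(−d) ↔ d ∉ {4, 8} ∧ d` not prime. [folklore] -/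
theorem two_dvd_classNumber_iff_not {d : ℕ} (hF : IsNegFundamentalDiscr d) :
    2 ∣ BinaryQuadraticForm.classNumber (-(d : ℤ)) ↔ ¬ (d = 4 ∨ d = 8 ∨ d.Prime) := by
  rw [two_dvd_classNumber_iff hF, ← card_primeFactors_le_one_iff hF]
  omega

/-! ### The `ℓ = 2` language and fundamentality recognition -/

/-- `IQ2`-set `= Fund ∖ ({4, 8} ∪ primes)`. [folklore] -/
theorem iqTwoSet_eq :
    {d : ℕ | IsNegFundamentalDiscr d ∧ 2 ∣ BinaryQuadraticForm.classNumber (-(d : ℤ))} =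
      {d : ℕ | IsNegFundamentalDiscr d} \ (({4, 8} : Set ℕ) ∪ {p : ℕ | p.Prime}) := by
  ext d
  simp only [Set.mem_setOf_eq, Set.mem_sdiff, Set.mem_union, Set.mem_insert_iff,
    Set.mem_singleton_iff]
  constructor
  · rintro ⟨hF, h2⟩
    exact ⟨hF, by have := (two_dvd_classNumber_iff_not hF).1 h2; rwa [or_assoc]⟩
  · rintro ⟨hF, hn⟩
    exact ⟨hF, (two_dvd_classNumber_iff_not hF).2 (by rwa [or_assoc] at hn)⟩

/-- `−4` and `−8` are fundamental. [folklore] -/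
theorem isNegFundamentalDiscr_four : IsNegFundamentalDiscr 4 := by
  right; exact ⟨by norm_num, by norm_num, by norm_num⟩

/-- `−8` is fundamental. [folklore] -/
theorem isNegFundamentalDiscr_eight : IsNegFundamentalDiscr 8 := by
  right
  refine ⟨by norm_num, by norm_num, ?_⟩
  rw [show (-((8 : ℕ) : ℤ)) / 4 = -2 by norm_num]
  exact (Int.prime_iff_natAbs_prime.2 (by norm_num)).squarefree

/-- `Fund = IQ2 ∪ {4, 8} ∪ (primes ≡ 3 (mod 4))`. [folklore] -/
theorem fundSet_eq :
    {d : ℕ | IsNegFundamentalDiscr d} =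
      {d : ℕ | IsNegFundamentalDiscr d ∧ 2 ∣ BinaryQuadraticForm.classNumber (-(d : ℤ))} ∪
        (({4, 8} : Set ℕ) ∪ ({p : ℕ | p.Prime} ∩ {n : ℕ | n % 4 = 3})) := by
  rw [iqTwoSet_eq]
  ext d
  simp only [Set.mem_setOf_eq, Set.mem_sdiff, Set.mem_union, Set.mem_insert_iff,
    Set.mem_singleton_iff, Set.mem_inter_iff]
  constructor
  · intro hF
    by_cases h : d = 4 ∨ d = 8 ∨ d.Prime
    · right
      rcases h with h | h | h
      · left; left; exact h
      · left; right; exact h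
      · right; exact ⟨h, mod_four_of_isNegFundamentalDiscr_of_prime hF h⟩
    · left; exact ⟨hF, by rwa [or_assoc]⟩
  · rintro (⟨hF, -⟩ | (rfl | rfl) | ⟨hp, h4⟩)
    · exact hF
    · exact isNegFundamentalDiscr_four
    · exact isNegFundamentalDiscr_eight
    · exact isNegFundamentalDiscr_of_prime hp h4

/-! ### `P/poly` bookkeeping -/

/-- `bin` commutes with unions. [folklore] -/
theorem toLanguage_union (A B : Set ℕ) :
    encodingNatBool.toLanguage (A ∪ B) = encodingNatBool.toLanguage A ⊔ encodingNatBool.toLanguage B :=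
  Set.image_union _ A B

/-- `bin` commutes with differences. [folklore] -/
theorem toLanguage_diff (A B : Set ℕ) :
    encodingNatBool.toLanguage (A \ B) = encodingNatBool.toLanguage A \ encodingNatBool.toLanguage B :=
  Set.image_sdiff encodingNatBool.encode_injective A B

/-- `P/poly` is closed under binary union. [folklore] -/
theorem union_mem_PPoly {L₁ L₂ : Language Bool} (h₁ : L₁ ∈ PPoly) (h₂ : L₂ ∈ PPoly) :
    L₁ ⊔ L₂ ∈ PPoly := by
  have h := compl_mem_PPoly (Literature.Computability.AlgebraicComplexity.inter_mem_PPoly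
    (compl_mem_PPoly h₁) (compl_mem_PPoly h₂))
  rwa [compl_inf, compl_compl, compl_compl] at h

/-- `P/poly` is closed under set difference. [folklore] -/
theorem diff_mem_PPoly {L₁ L₂ : Language Bool} (h₁ : L₁ ∈ PPoly) (h₂ : L₂ ∈ PPoly) :
    L₁ \ L₂ ∈ PPoly := by
  rw [sdiff_eq]
  exact Literature.Computability.AlgebraicComplexity.inter_mem_PPoly h₁ (compl_mem_PPoly h₂)

/-- `bin {4, 8} ∈ P/poly`. [folklore] -/
theorem binFourEight_mem_PPoly : encodingNatBool.toLanguage ({4, 8} : Set ℕ) ∈ PPoly :=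
  mem_PPoly_of_finite ((Set.toFinite ({4, 8} : Set ℕ)).image _)

/-- **`ℓ = 2`, first half: IQ2 is no harder than fundamentality recognition** —
`bin Fund ∈ P/poly → bin IQ2 ∈ P/poly` (genus theory + AKS + closure properties). [folklore] -/
theorem iqTwo_mem_PPoly_of_fund
    (hF : encodingNatBool.toLanguage {d : ℕ | IsNegFundamentalDiscr d} ∈ PPoly) :
    encodingNatBool.toLanguage
      {d : ℕ | IsNegFundamentalDiscr d ∧ 2 ∣ BinaryQuadraticForm.classNumber (-(d : ℤ))} ∈ PPoly := by
  rw [iqTwoSet_eq, toLanguage_diff, toLanguage_union]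
  exact diff_mem_PPoly hF (union_mem_PPoly binFourEight_mem_PPoly (P_subset_PPoly_holds PRIMES_mem_P'))

/-- **`ℓ = 2`, second half: fundamentality recognition is no harder than IQ2**:
`bin IQ2 ∈ P/poly → bin Fund ∈ P/poly` (the residue language `bin {n | n ≡ 3 (mod 4)}` has two-gate
circuits, `mod4_mem_PPoly`). [folklore] -/
theorem fund_mem_PPoly_of_iqTwo
    (h2 : encodingNatBool.toLanguage
      {d : ℕ | IsNegFundamentalDiscr d ∧ 2 ∣ BinaryQuadraticForm.classNumber (-(d : ℤ))} ∈ PPoly) :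
    encodingNatBool.toLanguage {d : ℕ | IsNegFundamentalDiscr d} ∈ PPoly := by
  rw [fundSet_eq, toLanguage_union, toLanguage_union, toLanguage_inter]
  exact union_mem_PPoly h2 (union_mem_PPoly binFourEight_mem_PPoly
    (Literature.Computability.AlgebraicComplexity.inter_mem_PPoly (P_subset_PPoly_holds PRIMES_mem_P')
      mod4_mem_PPoly))


/-- **THE `ℓ = 2` ANALOGUE OF THE CRUX IS EXACTLY FUNDAMENTALITY (SQUAREFREE) RECOGNITION**:
`bin {d | −d fundamental, 2 ∣ h(−d)} ∉ P/poly ↔ bin {d | −d fundamental} ∉ P/poly` — genus theory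
(`|Cl[2]| = 2^{ω(d)−1}`, PROVED in the tree) + AKS (PROVED in the tree) + closure of `P/poly`. So at
`ℓ = 2` the class group contributes nothing beyond recognising fundamental discriminants, a
factoring-computable task; `ℓ = 3` is the first prime where the crux can carry class-group content.
[folklore] -/
theorem iqTwoNotPPoly_iff_fundNotPPoly :
    encodingNatBool.toLanguage
        {d : ℕ | IsNegFundamentalDiscr d ∧ 2 ∣ BinaryQuadraticForm.classNumber (-(d : ℤ))} ∉ PPoly ↔
      encodingNatBool.toLanguage {d : ℕ | IsNegFundamentalDiscr d} ∉ PPoly :=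
  not_congr ⟨fun h => fund_mem_PPoly_of_iqTwo h, fun h => iqTwo_mem_PPoly_of_fund h⟩

end GenusTwo

/-! ### §3(a′) The full sandwich `Prime ⇒ Promise ⇒ X`, hypothesis-free

`PromiseIqThreeNotPPoly` is stated VERBATIM as in ideator-2's `SketchIdeator2.lean` (so the lead can
bridge by `Iff.rfl`): no polynomial-size family computes `[3 ∣ h(−d)]` on every fundamental `−d`.
`Promise ⇒ X` is the triviality "a language decider is a promise decider"; `Prime ⇒ Promise`
(ideator-2's `PrimeToPromiseStub`) is discharged here: AND a promise decider with a family deciding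
`PRIMES ⊓ bin {n ≡ 3 (4)}` (AKS + §3(b)'s two-gate residue circuits). -/

/-- **The promise core of the crux** (factoring-independent: fundamentality is promised): no
polynomial-size circuit family computes `[3 ∣ h(−d)]` correctly on every fundamental `−d`. Verbatim
ideator-2's statement. [folklore] -/
def PromiseIqThreeNotPPoly : Prop :=
  ¬ ∃ p : Polynomial ℕ, ∃ C : CircuitFamily, (∀ n, (C n).IsOver B2 ∧ (C n).size ≤ p.eval n) ∧
    ∀ d : ℕ, IsNegFundamentalDiscr d →
      (C (encodeNat d).length).eval (encodeNat d).get =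
        decide (3 ∣ BinaryQuadraticForm.classNumber (-(d : ℤ)))

/-- `Promise ⇒ X`: a decider of `IQ3` on all words is in particular correct on the promise
(ideator-2's `iqThreeNotPPoly_of_promise`, re-proved). [folklore] -/
theorem iqThreeNotPPoly_of_promise (h : PromiseIqThreeNotPPoly) : IqThreeNotPPoly := by
  rw [iqThreeNotPPoly_iff]
  intro hmem
  apply h
  simp only [PPoly, SIZE, Set.mem_iUnion, Set.mem_setOf_eq] at hmem
  obtain ⟨p, C, hC, hdec⟩ := hmem
  refine ⟨p, C, hC, fun d hd => ?_⟩
  rw [hdec (encodeNat d)]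
  have hiff : encodeNat d ∈ iqThreeLang ↔ 3 ∣ BinaryQuadraticForm.classNumber (-(d : ℤ)) := by
    rw [encodeNat_mem_iff]
    exact ⟨fun h' => h'.2, fun h' => ⟨hd, h'⟩⟩
  by_cases h3 : 3 ∣ BinaryQuadraticForm.classNumber (-(d : ℤ))
  · rw [decide_eq_true h3]
    exact (iqThreeLang.mem_iff_boolIndicator _).1 (hiff.2 h3)
  · rw [decide_eq_false h3]
    exact (iqThreeLang.notMem_iff_boolIndicator _).1 (fun h' => h3 (hiff.1 h'))

/-- AND of two circuit families, member-wise (one extra gate). [folklore] -/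
theorem exists_and_family (C D : CircuitFamily) (hC : ∀ n, (C n).IsOver B2) (hD : ∀ n, (D n).IsOver B2) :
    ∃ E : CircuitFamily, ∀ n, (E n).IsOver B2 ∧ (E n).size ≤ (C n).size + (D n).size + 1 ∧
      ∀ x, (E n).eval x = ((C n).eval x && (D n).eval x) := by
  have key : ∀ n, ∃ En : Circuit (Fin n), En.IsOver B2 ∧ En.size ≤ (C n).size + (D n).size + 1 ∧
      ∀ x, En.eval x = ((C n).eval x && (D n).eval x) := fun n => by
    have h1 := ((C n).cktSize_eval (hC n)).pair ((D n).cktSize_eval (hD n))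
    have h2 := h1.comp (cktSize_and (ι := Unit ⊕ Unit) (Sum.inl ()) (Sum.inr ()))
    have h3 : CktSize B2 (fun (x : Fin n → Bool) (_ : Unit) => ((C n).eval x && (D n).eval x))
        ((C n).size + (D n).size + 1) :=
      h2.congr fun x u => by simp
    exact h3.toCircuit
  choose E hE using key
  exact ⟨E, hE⟩

/-- **`Prime ⇒ Promise`** (ideator-2's `PrimeToPromiseStub`, discharged without hypotheses): from a
promise decider and the tree's circuits for `PRIMES` (AKS, `PRIMES_mem_P'`, `P ⊆ P/poly`) and for
`bin {n ≡ 3 (4)}` (`mod4_mem_PPoly`) one gets a decider of the prime core `IQ3′`. [folklore] -/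
theorem promise_of_prime (h : PrimeIqThreeNotPPoly) : PromiseIqThreeNotPPoly := by
  rintro ⟨p, C, hC, hprom⟩
  apply h
  -- circuits for `PRIMES ⊓ bin {n ≡ 3 (4)}`
  have hPM : PRIMES ⊓ encodingNatBool.toLanguage {n : ℕ | n % 4 = 3} ∈ PPoly :=
    Literature.Computability.AlgebraicComplexity.inter_mem_PPoly (P_subset_PPoly_holds PRIMES_mem_P')
      mod4_mem_PPoly
  simp only [PPoly, SIZE, Set.mem_iUnion, Set.mem_setOf_eq] at hPM
  obtain ⟨q, D, hD, hDdec⟩ := hPM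
  obtain ⟨E, hE⟩ := exists_and_family C D (fun n => (hC n).1) (fun n => (hD n).1)
  refine Set.mem_iUnion.2 ⟨p + q + 1, E, fun n => ⟨(hE n).1, ?_⟩, fun x => ?_⟩
  · calc (E n).size ≤ (C n).size + (D n).size + 1 := (hE n).2.1
      _ ≤ p.eval n + q.eval n + 1 := by
        have := (hC n).2; have := (hD n).2; omega
      _ = (p + q + 1).eval n := by simp
  · rw [(hE x.length).2.2 x.get, hDdec x]
    by_cases hx : x ∈ PRIMES ⊓ encodingNatBool.toLanguage {n : ℕ | n % 4 = 3}
    · -- `x = bin p`, `p` prime `≡ 3 (4)`: the promise decider is correct on `−p` fundamental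
      obtain ⟨⟨p', hp', rfl⟩, hx4⟩ := hx
      change p'.Prime at hp'
      have h4 : p' % 4 = 3 := (encodingNatBool.mem_toLanguage_iff _ p').1 hx4
      have hF : IsNegFundamentalDiscr p' := isNegFundamentalDiscr_of_prime hp' h4
      rw [((PRIMES ⊓ encodingNatBool.toLanguage {n : ℕ | n % 4 = 3}).mem_iff_boolIndicator _).1
        ⟨⟨p', hp', rfl⟩, hx4⟩, Bool.and_true]
      change (C (encodeNat p').length).eval (encodeNat p').get = primeIqThreeLang.boolIndicator (encodeNat p')
      rw [hprom p' hF]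
      have hiff : encodeNat p' ∈ primeIqThreeLang ↔ 3 ∣ BinaryQuadraticForm.classNumber (-(p' : ℤ)) := by
        change encodingNatBool.encode p' ∈ encodingNatBool.toLanguage primeIqThreeSet ↔ _
        rw [encodingNatBool.mem_toLanguage_iff]
        exact ⟨fun h' => h'.2.2, fun h' => ⟨hp', h4, h'⟩⟩
      by_cases h3 : 3 ∣ BinaryQuadraticForm.classNumber (-(p' : ℤ))
      · rw [decide_eq_true h3]
        exact ((primeIqThreeLang.mem_iff_boolIndicator _).1 (hiff.2 h3)).symm
      · rw [decide_eq_false h3]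
        exact ((primeIqThreeLang.notMem_iff_boolIndicator _).1 (fun h' => h3 (hiff.1 h'))).symm
    · -- outside `PRIMES ⊓ bin {≡ 3 (4)}`: both sides are `false`
      rw [((PRIMES ⊓ encodingNatBool.toLanguage {n : ℕ | n % 4 = 3}).notMem_iff_boolIndicator _).1 hx,
        Bool.and_false]
      symm
      apply (primeIqThreeLang.notMem_iff_boolIndicator _).1
      intro hx'
      apply hx
      -- `x ∈ IQ3′` forces `x = bin p'` with `p'` prime, `p' ≡ 3 (4)`
      obtain ⟨p', hp', rfl⟩ := hx'
      obtain ⟨hpr, h4, -⟩ := hp'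
      exact ⟨⟨p', hpr, rfl⟩, (encodingNatBool.mem_toLanguage_iff _ p').2 h4⟩

/-- The sandwich, assembled: `Prime ⇒ Promise ⇒ X`, all hypothesis-free in the tree. [folklore] -/
theorem sandwich : (PrimeIqThreeNotPPoly → PromiseIqThreeNotPPoly) ∧
    (PromiseIqThreeNotPPoly → IqThreeNotPPoly) :=
  ⟨promise_of_prime, iqThreeNotPPoly_of_promise⟩

/-! ### §4bis Numerical face of ¬S on primes: Dirichlet's residue count (sanity data)

For a prime `p ≡ 3 (mod 4)`, `p > 3`, Dirichlet's finite class number formula reads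
`h(−p) = (R − N)/(2 − (2/p))` with `R`/`N` the numbers of quadratic residues/non-residues in
`(0, p/2)`; `2R = #{x ∈ [1, p−1] : x² mod p < p/2}`. The formula itself is not in the tree; the
data below (kernel `decide`) check the resulting membership criterion
"`p ∈ S ⇔ 2R − (p−1)/2 ≡ 0 (mod 3)` if `p ≡ 7 (8)`, `(mod 9)` if `p ≡ 3 (8)`" on `p = 19, 23, 31, 43, 59`
against the class numbers `1, 3, 3, 1, 3`. -/

/-- `2R(19) = 12`: `2R − 9 = 3 ≢ 0 (mod 9)` (`19 ≡ 3 (8)`), matching `h(−19) = 1`. [folklore] -/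
theorem twoR_19 : ((Finset.Icc 1 18).filter (fun x => x * x % 19 < 10)).card = 12 := by decide

/-- `2R(23) = 14`: `2R − 11 = 3 ≡ 0 (mod 3)` (`23 ≡ 7 (8)`), matching `h(−23) = 3`. [folklore] -/
theorem twoR_23 : ((Finset.Icc 1 22).filter (fun x => x * x % 23 < 12)).card = 14 := by decide

/-- `2R(31) = 18`: `2R − 15 = 3 ≡ 0 (mod 3)` (`31 ≡ 7 (8)`), matching `h(−31) = 3`. [folklore] -/
theorem twoR_31 : ((Finset.Icc 1 30).filter (fun x => x * x % 31 < 16)).card = 18 := by decide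

set_option maxRecDepth 4000 in
/-- `h(−43) = 1`. [folklore] -/
theorem classNumber_neg_43 : BinaryQuadraticForm.classNumber (-43) = 1 := by decide

/-- `2R(43) = 24`: `2R − 21 = 3 ≢ 0 (mod 9)` (`43 ≡ 3 (8)`), matching `h(−43) = 1`. [folklore] -/
theorem twoR_43 : ((Finset.Icc 1 42).filter (fun x => x * x % 43 < 22)).card = 24 := by
  decide +kernel

set_option maxRecDepth 4000 in
/-- `h(−59) = 3`. [folklore] -/
theorem classNumber_neg_59 : BinaryQuadraticForm.classNumber (-59) = 3 := by decide

/-- `2R(59) = 38`: `2R − 29 = 9 ≡ 0 (mod 9)` (`59 ≡ 3 (8)`), matching `h(−59) = 3`. [folklore] -/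
theorem twoR_59 : ((Finset.Icc 1 58).filter (fun x => x * x % 59 < 30)).card = 38 := by
  decide +kernel

/-! ### §4ter The theta face on `d ≡ 3 (mod 8)`: `r₃(d) = 24·h(−d)` (sanity data)

Gauss–Legendre: for squarefree `d ≡ 3 (mod 8)`, `d > 3`, the number of representations as a sum of
three squares is `r₃(d) = 24 h(−d)`, so on this branch `d ∈ S ⇔ 9 ∣ r₃(d)` (ideator card
`theta-derivation-digit`: the second 3-adic digit of a theta coefficient). A refutation on this
branch = polynomial-size circuits for `#{(x,y,z) ∈ ℤ³ : x²+y²+z² = d} mod 9`; nothing of the kind is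
known (the first digit is free: `θ³ ≡ θ(q³) (mod 3)`). Kernel-checked instances: -/

/-- `r₃(11) = 24 = 24·h(−11)`. [folklore] -/
theorem r3_11 : (((Finset.Icc (-4 : ℤ) 4) ×ˢ ((Finset.Icc (-4 : ℤ) 4) ×ˢ (Finset.Icc (-4 : ℤ) 4))).filter
    (fun t => t.1 ^ 2 + t.2.1 ^ 2 + t.2.2 ^ 2 = 11)).card = 24 := by decide

/-- `h(−11) = 1`. [folklore] -/
theorem classNumber_neg_11 : BinaryQuadraticForm.classNumber (-11) = 1 := by decide

/-- `r₃(19) = 24 = 24·h(−19)`. [folklore] -/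
theorem r3_19 : (((Finset.Icc (-5 : ℤ) 5) ×ˢ ((Finset.Icc (-5 : ℤ) 5) ×ˢ (Finset.Icc (-5 : ℤ) 5))).filter
    (fun t => t.1 ^ 2 + t.2.1 ^ 2 + t.2.2 ^ 2 = 19)).card = 24 := by decide

/-- `r₃(35) = 48 = 24·h(−35)` (`h(−35) = 2`). [folklore] -/
theorem r3_35 : (((Finset.Icc (-6 : ℤ) 6) ×ˢ ((Finset.Icc (-6 : ℤ) 6) ×ˢ (Finset.Icc (-6 : ℤ) 6))).filter
    (fun t => t.1 ^ 2 + t.2.1 ^ 2 + t.2.2 ^ 2 = 35)).card = 48 := by decide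

/-- `h(−35) = 2`. [folklore] -/
theorem classNumber_neg_35 : BinaryQuadraticForm.classNumber (-35) = 2 := by decide

/-! ### §5 Targets (lead's stuck stubs)

None at cycle 1 (`payload.targets = []`, `stuck_stubs = []`).

### Prose record of the non-formalisable attacks (cycle 1)

* ALGORITHMIC (the only way to refute): class number / class group of `ℚ(√−d)` — Shanks
  baby-step giant-step `d^{1/4+ε}` (deterministic, `d^{1/5+ε}` under GRH), Hafner–McCurley 1989
  `L_d(1/2, √2+o(1))` expected UNDER GRH (doi:10.2307/1990896; Buchmann's extension; Biasse–Fieker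
  2014 in higher degree), all computing the whole group; `h(−d) mod 2^k` via genus theory / Rédei
  matrices / ambiguous forms is factoring-equivalent folklore; for ODD `ℓ` no method avoiding the
  full class group is in print — Scholz reflection only RELATES `rk₃ Cl(−d)` and `rk₃ Cl(3d)`;
  the 3-torsion ↔ cubic fields (Hasse) / 3-isogeny Selmer groups of `y² = x³ + k` dictionary moves the
  problem to objects with no known polynomial algorithms either. Non-uniformity does not help
  visibly: the truncated class number formula `h = (√d/π) L(1, χ)` needs `L(1,χ)` to relative error
  `< 1/h ≈ d^{-1/2}`, i.e. exponentially many Euler factors.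
* FURTHER AVENUES TO ¬S EXAMINED (all dead for now): (B) Scholz–Kummer mirror: on `d = 3m`,
  `3 ∣ h(−d)` is governed by `rk₃ Cl(ℚ(√m))` and the 3-primarity of the fundamental unit `ε_m`
  (ideator card `mirror-promise-split`); `ε_m` modulo `(3√−3)`-type ideals is readable from a compact
  representation, but FINDING one is regulator computation — subexponential under GRH, like the class
  group itself; even the norm sign of `ε_m` (negative Pell) has no known polynomial algorithm.
  (C) 3-descent on `j = 0` curves `y² = x³ + k`: the `φ`-Selmer groups that see `Cl(ℚ(√−3k))[3]`
  are themselves computed FROM those class groups (only the Cassels RATIO is local). (D) modular forms: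
  on `d ≡ 3 (8)`, `r₃(d) = 24 h(−d)` (Gauss), so ¬S on that branch = small circuits for
  `r₃(d) mod 9`; `θ³ ≡ θ(q³) (mod 3)` makes the first 3-adic digit free and the second one IS
  `h mod 3` (card `theta-derivation-digit`); Edixhoven–Couveignes-type polynomial-time coefficient
  algorithms need Galois representations of integral-weight eigenforms and do not reach
  squarefree-index coefficients of half-integral weight forms (which encode `L(1, χ_{−d})`, i.e. `h`).
  (E) dequantising the abelian HSP needs the group structure it is meant to find.
* CONSEQUENCES OF ¬S: none dramatic (unlike `¬ IqThreeMemBQP ⇒ P ≠ PSPACE`): `IQ3 ∈ P/poly` is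
  consistent with everything proved; the evidence for S is cryptographic/heuristic
  (Buchmann–Williams 1988, Hamdy–Möller 2000: class groups of random discriminants; Cohen–Lenstra:
  `h mod 3` equidistributes like a random finite abelian 3-group statistic).
* GRH TIGHTNESS: under GRH, IQ3 ∈ BPTIME(`2^{O(√(n log n))}`) ⊆ SIZE(`2^{O(√(n log n))}`), so no
  `2^{n^{1/2+ε}}` lower bound can be hoped for; the ladder's rungs (juntas, AC⁰) are far below.
* THE ELEMENTARY FACE OF ¬S ON PRIMES (Dirichlet's finite class number formula, `p ≡ 3 (4)`, `p > 3`: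
  `h(−p) = (R − N)/(2 − (2/p))`, `R`/`N` = number of quadratic residues/non-residues in `(0, p/2)`,
  `R + N = (p−1)/2`; checked numerically in §4bis on `p = 19, 23, 31, 43, 59`): `p ∈ IQ3 ⇔ 2R(p) ≡ (p−1)/2`
  modulo `3` if `p ≡ 7 (8)`, modulo `9` if `p ≡ 3 (8)`, where `R(p) = ½·#{x ∈ [1, p−1] : (x² mod p) < p/2}`.
  So a refutation needs, at the very least, polynomial-size circuits for "the number of squares
  landing in the lower half of `ℤ/p`, modulo 9" — a lattice-point count between parabolas modulo a
  constant, for which nothing better than `p^{θ}`-time counting is known. The `ℓ = 2` analogue of this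
  count is TRIVIAL (`R − N ≡ (p−1)/2 (mod 2)`), matching genus theory (`h(−p)` odd): a one-line
  explanation of why parity is easy and 3-divisibility is not visibly so.
* CRYPTOGRAPHIC STATUS (evidence for S, against a kill): Belabas–Kleinjung–Sanso–Wesolowski 2020
  (ePrint 2020/1310, "A note on the low order assumption in class groups of imaginary quadratic number
  fields"), p. 2: "While the Cohen–Lenstra heuristics suggest that the class group often contains
  elements of small odd order it seems out of reach by current techniques to find such low order
  forms"; p. 6: exhibiting order-3 classes via binary cubic forms / Bhargava cubes works "without even
  computing the class number. Unfortunately, the corresponding algorithms are more expensive than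
  class group computations." Deciding `3 ∣ h` (our IQ3) is formally weaker than finding an order-3
  class, but no separate decision method is in print. Special families where membership is free
  (their Thm 1: `d = 4u³ − 1`; Shanks: `d = 2^q − 1 ⇒ (q − 2) ∣ h(−d)`) are sparse and do not bear on
  `P/poly`-membership of the whole language.
* INFINITUDE both ways (so no finite/cofinite shortcut, cf. §4(d)): infinitely many fundamental `−d`
  with `3 ∣ h(−d)` (Nagell 1922) and with `3 ∤ h(−d)` (Hartung 1974, JNT 6, doi:10.1016/0022-314x(74)90022-5);
  quantitatively Davenport–Heilbronn. Not formalised (would need the form-class-group structure).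
-/

end Summit.QuantumAdvantage.QuantumAdvantage.Cruxes.IqThreeNotPPoly.Disproof

end
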